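import Mathlib

/-!
# The set-partition exponential of a set function (the "exponential formula", finite form)

For a weight `f : Finset α → R` on finite subsets of a linearly ordered type, the **set
exponential** `setExp f S = Σ_{π ∈ Partitions(S)} ∏_{B ∈ π} f B` is defined here by the
"block of the least element" recursion
`setExp f S = Σ_{B ⊆ S ∖ {min S}} f ({min S} ∪ B) · setExp f ((S ∖ {min S}) ∖ B)`, `setExp f ∅ = 1`,
which is the standard way of generating set partitions (Stanley, *Enumerative Combinatorics* vol. 2
[Stanley1999EC2], §5.1, Cor. 5.1.6 — the exponential formula; here in its elementary finite form,
valid over any commutative semiring; the lemmas below are routine consequences and carry the same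
citation as their source of record).  We prove the basic calculus used by the matrix-forest formulae of
`Literature/LinearAlgebra/Matrix/BipartiteForestFormula.lean`:

* `setExp_peel` — the recursion holds with ANY pivot `a ∈ S` in place of `min S`;
* `setExp_congr` — `setExp f S` only depends on `f` on the nonempty subsets of `S`;
* `setExp_add` — `setExp (f + g) S = Σ_{E ⊆ S} setExp g E · setExp f (S ∖ E)` (the exponential of a
  sum is the subset-convolution of the exponentials);
* `setExp_point` — pointing a block with an additive weight:
  `Σ_{∅ ≠ E ⊆ S} (Σ_{i∈E} w i) · g E · setExp g (S ∖ E) = (Σ_{i∈S} w i) · setExp g S`.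

No `Finpartition` is used; everything is finite sums over powersets.
-/

namespace Literature.Combinatorics.Enumerative

open Finset

variable {α : Type*} [LinearOrder α] {R : Type*} [CommSemiring R]

/-- The **set exponential** of a weight `f` on finite sets: the sum over all set partitions `π` of
`S` of `∏_{B ∈ π} f B`, generated by the recursion on the block containing the least element of
`S` (empty set: `1`). [cite: Stanley1999EC2, Cor. 5.1.6 (the exponential formula), finite block-recursion form] -/
def setExp (f : Finset α → R) : Finset α → R := fun S =>
  if h : S.Nonempty then
    ∑ B ∈ (S.erase (S.min' h)).powerset,
      f (insert (S.min' h) B) * setExp f (S.erase (S.min' h) \ B)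
  else 1
termination_by S => S.card
decreasing_by
  exact lt_of_le_of_lt (Finset.card_le_card Finset.sdiff_subset)
    (Finset.card_erase_lt_of_mem (Finset.min'_mem _ h))

/-- The set exponential of the empty set is `1` (the empty partition). [cite: Stanley1999EC2, Cor. 5.1.6 (exponential formula; elementary finite form)] -/
theorem setExp_empty (f : Finset α → R) : setExp f (∅ : Finset α) = 1 := by
  rw [setExp, dif_neg Finset.not_nonempty_empty]

/-- Unfolding the defining recursion at the least element. [cite: Stanley1999EC2, Cor. 5.1.6 (exponential formula; elementary finite form)] -/
theorem setExp_of_nonempty (f : Finset α → R) {S : Finset α} (h : S.Nonempty) :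
    setExp f S = ∑ B ∈ (S.erase (S.min' h)).powerset,
      f (insert (S.min' h) B) * setExp f (S.erase (S.min' h) \ B) := by
  rw [setExp, dif_pos h]

/-- Auxiliary rearrangement: for `T` a finite set, the double sums
`Σ_{B ⊆ T} Σ_{C ⊆ T ∖ B} φ B C` and `Σ_{C ⊆ T} Σ_{B ⊆ T ∖ C} φ B C` agree (both run over the ordered
pairs of disjoint subsets of `T`). [cite: Stanley1999EC2, Cor. 5.1.6 (exponential formula; elementary finite form)] -/
theorem sum_powerset_sum_powerset_sdiff_comm (T : Finset α) (φ : Finset α → Finset α → R) :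
    ∑ B ∈ T.powerset, ∑ C ∈ (T \ B).powerset, φ B C =
      ∑ C ∈ T.powerset, ∑ B ∈ (T \ C).powerset, φ B C := by
  refine Finset.sum_comm' fun B C => ?_
  simp only [Finset.mem_powerset]
  constructor
  · rintro ⟨hB, hC⟩
    refine ⟨fun x hx => ?_, hC.trans Finset.sdiff_subset⟩
    rw [Finset.mem_sdiff]
    exact ⟨hB hx, fun hxC => (Finset.mem_sdiff.mp (hC hxC)).2 hx⟩
  · rintro ⟨hB, hC⟩
    refine ⟨hB.trans Finset.sdiff_subset, fun x hx => ?_⟩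
    rw [Finset.mem_sdiff]
    exact ⟨hC hx, fun hxB => (Finset.mem_sdiff.mp (hB hxB)).2 hx⟩

/-- **Pivot independence.** The block recursion of the set exponential holds with any element
`a ∈ S` as pivot: `setExp f S = Σ_{B ⊆ S ∖ {a}} f ({a} ∪ B) · setExp f ((S ∖ {a}) ∖ B)`. [cite: Stanley1999EC2, Cor. 5.1.6 (exponential formula; elementary finite form)] -/
theorem setExp_peel (f : Finset α → R) {S : Finset α} {a : α} (ha : a ∈ S) :
    setExp f S = ∑ B ∈ (S.erase a).powerset, f (insert a B) * setExp f (S.erase a \ B) := by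
  suffices H : ∀ (n : ℕ) (S : Finset α), S.card = n → ∀ a ∈ S,
      setExp f S = ∑ B ∈ (S.erase a).powerset, f (insert a B) * setExp f (S.erase a \ B) from
    H _ S rfl a ha
  intro n
  induction n using Nat.strong_induction_on with
  | _ n ih =>
  intro S hn a ha
  have hS : S.Nonempty := ⟨a, ha⟩
  set m := S.min' hS with hm
  have hmS : m ∈ S := S.min'_mem hS
  by_cases ham : a = m
  · rw [ham]; exact setExp_of_nonempty f hS
  -- the common refinement `T = S ∖ {m, a}`
  set T := (S.erase m).erase a with hT
  have haT : a ∉ T := Finset.notMem_erase a _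
  have hmT : m ∉ T := by
    rw [hT, Finset.mem_erase, Finset.mem_erase]; tauto
  have haSm : a ∈ S.erase m := Finset.mem_erase.mpr ⟨ham, ha⟩
  have hmSa : m ∈ S.erase a := Finset.mem_erase.mpr ⟨fun h => ham h.symm, hmS⟩
  have hSm : S.erase m = insert a T := by
    rw [hT, Finset.insert_erase haSm]
  have hSa : S.erase a = insert m T := by
    rw [hT, Finset.erase_right_comm, Finset.insert_erase hmSa]
  have hcardT : ∀ B : Finset α, (insert a (T \ B)).card < n ∧ (insert m (T \ B)).card < n := by
    intro B
    have h1 : (T \ B).card ≤ T.card := Finset.card_le_card Finset.sdiff_subset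
    have h2 : T.card + 2 = n := by
      rw [hT, Finset.card_erase_of_mem haSm, Finset.card_erase_of_mem hmS, ← hn]
      have : 0 < (S.erase m).card := Finset.card_pos.mpr ⟨a, haSm⟩
      rw [Finset.card_erase_of_mem hmS] at this
      omega
    constructor
    · calc (insert a (T \ B)).card ≤ (T \ B).card + 1 := Finset.card_insert_le _ _
        _ < n := by omega
    · calc (insert m (T \ B)).card ≤ (T \ B).card + 1 := Finset.card_insert_le _ _
        _ < n := by omega
  -- expand both sides, splitting the pivot block by membership of the other pivot
  rw [setExp_of_nonempty f hS, ← hm, hSm, Finset.sum_powerset_insert haT, hSa,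
    Finset.sum_powerset_insert hmT]
  -- inner expansions by the induction hypothesis
  have hL : ∀ B ∈ T.powerset, f (insert m B) * setExp f (insert a T \ B) =
      ∑ C ∈ (T \ B).powerset, f (insert m B) * (f (insert a C) * setExp f ((T \ B) \ C)) := by
    intro B hB
    rw [Finset.mem_powerset] at hB
    have hsd : insert a T \ B = insert a (T \ B) :=
      Finset.insert_sdiff_of_notMem _ (fun h => haT (hB h))
    rw [hsd, ih _ (hcardT B).1 _ rfl a (Finset.mem_insert_self a _), Finset.erase_insert
      (fun h => haT (Finset.mem_sdiff.mp h).1), Finset.mul_sum]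
  have hR : ∀ C ∈ T.powerset, f (insert a C) * setExp f (insert m T \ C) =
      ∑ B ∈ (T \ C).powerset, f (insert a C) * (f (insert m B) * setExp f ((T \ C) \ B)) := by
    intro C hC
    rw [Finset.mem_powerset] at hC
    have hsd : insert m T \ C = insert m (T \ C) :=
      Finset.insert_sdiff_of_notMem _ (fun h => hmT (hC h))
    rw [hsd, ih _ (hcardT C).2 _ rfl m (Finset.mem_insert_self m _), Finset.erase_insert
      (fun h => hmT (Finset.mem_sdiff.mp h).1), Finset.mul_sum]
  rw [Finset.sum_congr rfl hL, Finset.sum_congr rfl hR]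
  congr 1
  · rw [sum_powerset_sum_powerset_sdiff_comm]
    refine Finset.sum_congr rfl fun C _ => Finset.sum_congr rfl fun B _ => ?_
    rw [sdiff_right_comm]; ring
  · refine Finset.sum_congr rfl fun B hB => ?_
    have h1 : insert a T \ insert a B = T \ B := by
      rw [Finset.insert_sdiff_insert, Finset.sdiff_insert_of_notMem haT]
    have h2 : insert m T \ insert m B = T \ B := by
      rw [Finset.insert_sdiff_insert, Finset.sdiff_insert_of_notMem hmT]
    rw [h1, h2, Finset.insert_comm]

/-- Peeling at an element `s ∉ D₀` of `insert s D₀`. [cite: Stanley1999EC2, Cor. 5.1.6 (exponential formula; elementary finite form)] -/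
theorem setExp_insert (f : Finset α → R) {D₀ : Finset α} {s : α} (hs : s ∉ D₀) :
    setExp f (insert s D₀) = ∑ B ∈ D₀.powerset, f (insert s B) * setExp f (D₀ \ B) := by
  rw [setExp_peel f (Finset.mem_insert_self s D₀), Finset.erase_insert hs]

/-- The set exponential of `S` depends only on the weight of the nonempty subsets of `S`.
[cite: Stanley1999EC2, Cor. 5.1.6 (exponential formula; elementary finite form)] -/
theorem setExp_congr {f g : Finset α → R} {S : Finset α}
    (h : ∀ B, B ⊆ S → B.Nonempty → f B = g B) : setExp f S = setExp g S := by
  suffices H : ∀ (n : ℕ) (S : Finset α), S.card = n →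
      (∀ B, B ⊆ S → B.Nonempty → f B = g B) → setExp f S = setExp g S from H _ S rfl h
  intro n
  induction n using Nat.strong_induction_on with
  | _ n ih =>
  intro S hn h
  by_cases hS : S.Nonempty
  · rw [setExp_of_nonempty f hS, setExp_of_nonempty g hS]
    refine Finset.sum_congr rfl fun B hB => ?_
    rw [Finset.mem_powerset] at hB
    have hBS : insert (S.min' hS) B ⊆ S :=
      Finset.insert_subset (S.min'_mem hS) (hB.trans (Finset.erase_subset _ _))
    have hlt : (S.erase (S.min' hS) \ B).card < n :=
      hn ▸ lt_of_le_of_lt (Finset.card_le_card Finset.sdiff_subset)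
        (Finset.card_erase_lt_of_mem (S.min'_mem hS))
    rw [h _ hBS (Finset.insert_nonempty _ _), ih _ hlt _ rfl
      (fun C hC hCne => h C (hC.trans (Finset.sdiff_subset.trans (Finset.erase_subset _ _))) hCne)]
  · rw [Finset.not_nonempty_iff_eq_empty] at hS
    rw [hS, setExp_empty, setExp_empty]

/-- Auxiliary rearrangement: `Σ_{E ⊆ T} Σ_{B ⊆ E} ψ B E = Σ_{B ⊆ T} Σ_{C ⊆ T ∖ B} ψ B (B ∪ C)`
(both run over the pairs `B ⊆ E ⊆ T`, `E = B ∪ C`). [cite: Stanley1999EC2, Cor. 5.1.6 (exponential formula; elementary finite form)] -/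
theorem sum_powerset_sum_powerset_sub (T : Finset α) (ψ : Finset α → Finset α → R) :
    ∑ E ∈ T.powerset, ∑ B ∈ E.powerset, ψ B E =
      ∑ B ∈ T.powerset, ∑ C ∈ (T \ B).powerset, ψ B (B ∪ C) := by
  rw [Finset.sum_comm' (t' := T.powerset) (s' := fun B => T.powerset.filter (fun E => B ⊆ E))
    (fun E B => by
      simp only [Finset.mem_powerset, Finset.mem_filter]
      exact ⟨fun ⟨hE, hB⟩ => ⟨⟨hE, hB⟩, hB.trans hE⟩, fun ⟨⟨hE, hB⟩, _⟩ => ⟨hE, hB⟩⟩)]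
  refine Finset.sum_congr rfl fun B hB => ?_
  rw [Finset.mem_powerset] at hB
  have himg : T.powerset.filter (fun E => B ⊆ E) = (T \ B).powerset.image (fun C => B ∪ C) := by
    ext E
    simp only [Finset.mem_filter, Finset.mem_powerset, Finset.mem_image]
    constructor
    · rintro ⟨hE, hBE⟩
      exact ⟨E \ B, Finset.sdiff_subset_sdiff hE le_rfl, Finset.union_sdiff_of_subset hBE⟩
    · rintro ⟨C, hC, rfl⟩
      exact ⟨Finset.union_subset hB (hC.trans Finset.sdiff_subset), Finset.subset_union_left⟩
  rw [himg, Finset.sum_image]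
  intro C hC C' hC' hCC'
  rw [Finset.mem_coe, Finset.mem_powerset] at hC hC'
  have h1 : (B ∪ C) \ B = C := Finset.union_sdiff_cancel_left
    (Finset.disjoint_of_subset_right hC Finset.disjoint_sdiff)
  have h2 : (B ∪ C') \ B = C' := Finset.union_sdiff_cancel_left
    (Finset.disjoint_of_subset_right hC' Finset.disjoint_sdiff)
  dsimp only at hCC'
  rw [← h1, ← h2, hCC']

/-- **The exponential of a sum is the convolution of the exponentials**:
`setExp (f + g) S = Σ_{E ⊆ S} setExp g E · setExp f (S ∖ E)` (choose which blocks carry `g`).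
[cite: Stanley1999EC2, Cor. 5.1.6 (exponential formula; elementary finite form)] -/
theorem setExp_add (f g : Finset α → R) (S : Finset α) :
    setExp (f + g) S = ∑ E ∈ S.powerset, setExp g E * setExp f (S \ E) := by
  suffices H : ∀ (n : ℕ) (S : Finset α), S.card = n →
      setExp (f + g) S = ∑ E ∈ S.powerset, setExp g E * setExp f (S \ E) from H _ S rfl
  intro n
  induction n using Nat.strong_induction_on with
  | _ n ih =>
  intro S hn
  by_cases hS : S.Nonempty
  swap
  · rw [Finset.not_nonempty_iff_eq_empty] at hS
    rw [hS, setExp_empty, Finset.powerset_empty, Finset.sum_singleton, Finset.sdiff_self,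
      setExp_empty, setExp_empty, mul_one]
  set m := S.min' hS with hm
  set T := S.erase m with hT
  have hmT : m ∉ T := Finset.notMem_erase m S
  have hST : S = insert m T := (Finset.insert_erase (S.min'_mem hS)).symm
  have hcard : ∀ B : Finset α, (T \ B).card < n := fun B =>
    lt_of_le_of_lt (Finset.card_le_card Finset.sdiff_subset)
      (hn ▸ Finset.card_erase_lt_of_mem (S.min'_mem hS))
  rw [setExp_of_nonempty _ hS, ← hm, ← hT]
  conv_rhs => rw [hST, Finset.sum_powerset_insert hmT]
  -- left: expand the inner exponential by induction
  have hL : ∀ B ∈ T.powerset, (f + g) (insert m B) * setExp (f + g) (T \ B) =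
      (∑ E ∈ (T \ B).powerset, f (insert m B) * (setExp g E * setExp f ((T \ B) \ E))) +
      ∑ E ∈ (T \ B).powerset, g (insert m B) * (setExp g E * setExp f ((T \ B) \ E)) := by
    intro B _
    rw [ih _ (hcard B) _ rfl, Pi.add_apply, add_mul, Finset.mul_sum, Finset.mul_sum]
  -- right, first part: `m ∉ E`, peel `setExp f` at `m`
  have hR1 : ∀ E ∈ T.powerset, setExp g E * setExp f (insert m T \ E) =
      ∑ B ∈ (T \ E).powerset, setExp g E * (f (insert m B) * setExp f ((T \ E) \ B)) := by
    intro E hE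
    rw [Finset.mem_powerset] at hE
    rw [Finset.insert_sdiff_of_notMem _ (fun h => hmT (hE h)),
      setExp_insert f (fun h => hmT (Finset.mem_sdiff.mp h).1), Finset.mul_sum]
  -- right, second part: `m ∈ E`, peel `setExp g` at `m`
  have hR2 : ∀ E ∈ T.powerset, setExp g (insert m E) * setExp f (insert m T \ insert m E) =
      ∑ B ∈ E.powerset, g (insert m B) * (setExp g (E \ B) * setExp f (T \ E)) := by
    intro E hE
    rw [Finset.mem_powerset] at hE
    rw [Finset.insert_sdiff_insert, Finset.sdiff_insert_of_notMem hmT,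
      setExp_insert g (fun h => hmT (hE h)), Finset.sum_mul]
    refine Finset.sum_congr rfl fun B _ => ?_
    ring
  rw [Finset.sum_congr rfl hL, Finset.sum_add_distrib, Finset.sum_congr rfl hR1,
    Finset.sum_congr rfl hR2]
  congr 1
  · rw [sum_powerset_sum_powerset_sdiff_comm]
    refine Finset.sum_congr rfl fun E _ => Finset.sum_congr rfl fun B _ => ?_
    rw [sdiff_right_comm]; ring
  · rw [sum_powerset_sum_powerset_sub]
    refine Finset.sum_congr rfl fun B _ => Finset.sum_congr rfl fun E hE => ?_
    rw [Finset.mem_powerset] at hE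
    rw [Finset.union_sdiff_cancel_left (Finset.disjoint_of_subset_right hE Finset.disjoint_sdiff),
      sdiff_sdiff_left, Finset.sup_eq_union]

/-- **Pointing a block with an additive weight.** For `w : α → R` and any block weight `g`,
`Σ_{E ⊆ S} (Σ_{i ∈ E} w i) · g E · setExp g (S ∖ E) = (Σ_{i ∈ S} w i) · setExp g S`: marking one
block of a partition by the additive weight `Σ_{i∈E} w i` and summing over the marked block gives
the total weight times the unmarked sum (the `E = ∅` term vanishes). [cite: Stanley1999EC2, Cor. 5.1.6 (exponential formula; elementary finite form)] -/
theorem setExp_point (w : α → R) (g : Finset α → R) (S : Finset α) :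
    ∑ E ∈ S.powerset, (∑ i ∈ E, w i) * (g E * setExp g (S \ E)) =
      (∑ i ∈ S, w i) * setExp g S := by
  suffices H : ∀ (n : ℕ) (S : Finset α), S.card = n →
      ∑ E ∈ S.powerset, (∑ i ∈ E, w i) * (g E * setExp g (S \ E)) =
        (∑ i ∈ S, w i) * setExp g S from H _ S rfl
  intro n
  induction n using Nat.strong_induction_on with
  | _ n ih =>
  intro S hn
  by_cases hS : S.Nonempty
  swap
  · rw [Finset.not_nonempty_iff_eq_empty] at hS
    rw [hS, Finset.powerset_empty, Finset.sum_singleton, Finset.sum_empty, zero_mul,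
      zero_mul]
  set m := S.min' hS with hm
  set T := S.erase m with hT
  have hmT : m ∉ T := Finset.notMem_erase m S
  have hST : S = insert m T := (Finset.insert_erase (S.min'_mem hS)).symm
  have hcard : ∀ B : Finset α, (T \ B).card < n := fun B =>
    lt_of_le_of_lt (Finset.card_le_card Finset.sdiff_subset)
      (hn ▸ Finset.card_erase_lt_of_mem (S.min'_mem hS))
  rw [setExp_of_nonempty _ hS, ← hm, ← hT]
  conv_lhs => rw [hST, Finset.sum_powerset_insert hmT]
  have h1 : ∀ E ∈ T.powerset, (∑ i ∈ E, w i) * (g E * setExp g (insert m T \ E)) =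
      ∑ B ∈ (T \ E).powerset,
        g (insert m B) * ((∑ i ∈ E, w i) * (g E * setExp g ((T \ E) \ B))) := by
    intro E hE
    rw [Finset.mem_powerset] at hE
    rw [Finset.insert_sdiff_of_notMem _ (fun h => hmT (hE h)),
      setExp_insert g (fun h => hmT (Finset.mem_sdiff.mp h).1), Finset.mul_sum, Finset.mul_sum]
    refine Finset.sum_congr rfl fun B _ => ?_
    ring
  have h2 : ∀ E ∈ T.powerset, (∑ i ∈ insert m E, w i) * (g (insert m E) *
      setExp g (insert m T \ insert m E)) =
      (∑ i ∈ insert m E, w i) * (g (insert m E) * setExp g (T \ E)) := by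
    intro E _
    rw [Finset.insert_sdiff_insert, Finset.sdiff_insert_of_notMem hmT]
  rw [Finset.sum_congr rfl h1, Finset.sum_congr rfl h2, sum_powerset_sum_powerset_sdiff_comm,
    Finset.mul_sum, ← Finset.sum_add_distrib]
  refine Finset.sum_congr rfl fun B hB => ?_
  rw [Finset.mem_powerset] at hB
  have hinner : ∑ E ∈ (T \ B).powerset, (∑ i ∈ E, w i) * (g E * setExp g ((T \ E) \ B)) =
      (∑ i ∈ T \ B, w i) * setExp g (T \ B) := by
    rw [← ih _ (hcard B) _ rfl]
    exact Finset.sum_congr rfl fun E _ => by rw [sdiff_right_comm]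
  rw [← Finset.mul_sum, hinner]
  have hsplit : ∑ i ∈ S, w i = (∑ i ∈ T \ B, w i) + ∑ i ∈ insert m B, w i := by
    rw [hST, Finset.sum_insert hmT, Finset.sum_insert (fun h => hmT (hB h)),
      ← Finset.sum_sdiff hB]
    ring
  rw [hsplit]
  ring

end Literature.Combinatorics.Enumerative
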